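import Literature.MathematicalPhysics.QuantumFieldTheory.Balaban1983to89.T4MatchingClosureTwoRun
import Literature.MathematicalPhysics.QuantumFieldTheory.Balaban1983to89.T4MatchingClosureYoung
import Literature.MathematicalPhysics.QuantumFieldTheory.Balaban1983to89.T4EpochHorizon

/-!
# `Balaban1983to89.T4MatchingClosureBirth` — BY-NAME SEAM (γ): the young RATE clause of `StepBudget` from BIRTH-STEP
two-run rates, the window membership DISCHARGED BY NAME by Lemma Y end to end on a geometric genealogy ledger
(cell `pub-balaban`, SURGE NODE PROVER #02 lineage = node-U5 closure / assembler; T4-DAG v15 U5 block; journal self-row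
T4-U5.E-CLOSE*-BIRTH; record `t4/T4-EST-U5.md` §0 (q); imports `T4MatchingClosureTwoRun` v1 (p184082),
`T4MatchingClosureYoung` v1 (p183514) and unit pv25's `T4EpochHorizon` v1.1 (p184243) ONLY, modifies nothing)

HONEST FRAMING (cell `pub-balaban`, T4-DAG PAGE 1).  The cell's T4 target is the existence AND uniqueness of the
continuum limit of Bałaban's unit-scale averaged loop expectations on a finite torus — strictly beyond ultraviolet
stability ([Balaban1988Convergent] Cor. 3 p. 264; [Balaban1989LargeFieldII] Thm 1 p. 355); it is NOT infinite volume,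
NOT a mass gap, NOT the Clay problem.  This module is KERNEL BOOKKEEPING ONLY (one-line compositions and `θ`-power
arithmetic; 0 estimates, 0 definitions).  It is the third seam of the node-U5 two-run matching design, written BY NAME
between landed leaves of three lineages and kept out of all of them (each stays import-minimal):
* SEAM (α) (`T4MatchingClosureYoung`, this lineage gen 12): the sub-linear window binder `hW` of the closure discharged
  at Lemma Y's canonical window `W := youngWindow`, and the RATE SEAM in arithmetic form — a birth-step rate `C_r·θ^b`
  with `j ≤ b + ℓ`, `ℓ < W(K)` is at most the window rate `C_r·θ^j·θ^{−W(K)}` (`youngRate_of_lifetime_lt`), the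
  lifetime bound `ℓ < youngWindow … K` taken BY NAME from `T4BankAgeYoung.lifetime_lt_youngWindow` with its ABSTRACT
  ledger data (`Ψ, f, v, σ, d′, len` and the horizon binder `hlen`);
* SEAM (β) (`T4MatchingClosureTwoRun`, gen 12): unit pv05's per-step two-run budget at every step of the log window IS
  a `T4MatchingClosureFed.StepBudget` (`stepBudget_of_twoRun`), GIVEN an abstract young rate profile `ry` with the
  clause `hry : 0 ≤ ry j ≤ C_r·θ^j·θ^{−W(K)}` and the per-polymer rate hypothesis `hrate` stated with `ry j`;
* THE PRODUCER of the lifetime bound on sub-history-shaped data (unit pv25 gen 8, `T4EpochHorizon` v1.1 §4):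
  `lifetime_lt_youngWindow_of_geometric_stopping` — for a `Geometric` geometric genealogy ledger
  (`T4GeometricLedger.GeoLedger`: domains, exponent profiles, `S`-step counts, born regions; the cover profiles of the
  epoch bases ARE the halving profiles and the horizon sentence of p. 385 is discharged by the stopping rule with
  memory `N = R_j`) the total lifetime `Σ_{i ≤ E} steps (base i)` is `< youngWindow d L₁ r (modelC d) C′ x̄ c̄ K`,
  every remaining hypothesis a named binder (the S-side credits `hDD hce hp hP5 hb hbA`, the flow of (I.0.20) up to
  `K` with its typed (2.5) windows, start scales `s i ≤ K`, the size parameter `Nsz ≥ 64`, per-epoch cleanliness, the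
  STOPPING READING).

WHAT THIS LEAF DOES, EXACTLY (no over-claim).  (§1) ONE SUB-HISTORY: `youngRate_of_lifetime_lt` ∘
`lifetime_lt_youngWindow_of_geometric_stopping` — a young sub-history met at step `j`, born at step `b`, whose
genealogy ledger is `Geometric` and obeys the producer's binders at cutoff `K`, and whose epochs cover `j`
(`j ≤ b + Σ_{i ≤ E} steps (base i)`, binder `hcover`), satisfies `j ≤ b + youngWindow … K`
(`step_le_birth_add_youngWindow_of_geometric_stopping`) and carries at most the window rate
`C_r·θ^b ≤ C_r·θ^j·θ^{−youngWindow … K}` (`youngRate_of_geometric_stopping`): the free lifetime binder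
`hℓ : ℓ < W K` of seam (α) is GONE, replaced by the producer's named binders; no abstract profile (`Ψ, f, v, σ, d′,
len, hlen`) is left.  (§2) THE WINDOW, TWO-RUN LEVEL: `stepBudget_of_twoRun_birth` / `remnant_le_of_twoRun_birth` /
`steps_feed_of_twoRun_birth` = seam (β)'s three theorems with the abstract rate triple (`ry`, `hry`, `hrate`)
REPLACED by birth-step data — a birth map `birth : step → polymer → ℕ`, the two-run rate AT THE BIRTH STEP
`‖w_A − w_B‖ ≤ C_r·θ^{birth j Z}·(A e^{−R d})` on the young discrepant polymers (`hbirth`), and the window clause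
`j ≤ birth j Z + W(K)` (`hwin`); the rate profile fed to `StepBudget` is the saturating one `ry j := C_r·θ^j·θ^{−W(K)}`
(`0 < θ ≤ 1`, `0 ≤ C_r`; `windowRate_clause`, `hrate_of_birth`).  (§3) THE TWO JOINED at
`W := youngWindow dd L₁ r (modelC dd) C′ x̄ c̄`: the window clause `hwin` DISCHARGED per young discrepant polymer by §1
from a `Geometric` genealogy ledger `G j Z` of its hosting sub-history with the producer's binders (per polymer:
`hG h0 hc hDD hbk hbA hst hclean hstop hcover`; uniform: the S-side constants `c_e, c_s, p̄₀`, ONE flow per cutoff with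
its (2.5) windows, `Nsz`) — `window_of_geometric_stopping`, `stepBudget_of_twoRun_geometric`,
`steps_feed_of_twoRun_geometric`: a `StepBudget` at the canonical young window whose remaining binders are, by name,
the producers' obligations and nothing else.  (§4) Non-vacuity: §1 is inhabited AT A POSITIVE CUTOFF (`K = 1`, age
cut `⌈10·log 2⌉₊ > 6`, the test ledger `geoEx` of `T4GeometricLedger` §4, the flat flow) — an inhabited instance of the
(Y3) form (`T4EpochHorizon` §4 exercised the flow form at `K = 0`); §2 and §3 are inhabited by the empty catalogue.

NOT DONE HERE (the producers' obligations; NOT PRINTED as such; proved nowhere in the tree): that Bałaban's young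
remnant activities carry the two-run rate `C_r·θ^{birth step}` AT THE ACTIVITY LEVEL (cell nodes NE-R1 two-run half /
NE2⁺-LF / U5a — the binder `hbirth`; print's one-run, AGE-FREE activity bounds [Balaban1989LargeFieldII] (1.97) at the
foot of p. 389, (1.98)–(1.100) on p. 390 are the FORMAT only — LOCATIONS, nothing quoted); that the sub-history hosting a
young polymer met at step `j` IS a `Geometric` genealogy ledger born at `birth j Z` whose epochs cover `[birth j Z, j]`
(the binders `G, hG, h0, hc, hcover` — the standing identification «a printed sub-history = a genealogy ledger» of the
pv25 lineage's record `t4/T4-EST-U5E-rem.md` §4, cell analysis); the S-side credits, the flow of (I.0.20) with its (2.5)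
windows, cleanliness and the STOPPING READING (binders of `T4EpochHorizon` §4, verbatim here); the old-born SIZE
`ρ^{A(K)}`, (1.26)_rel, the volume bound, footprint locality, the KP smallness, the cube counts and the domination `hRem`
(binders of seam (β), verbatim here).  No `StepBudget` / `RemnantSplitBudget` is INSTANTIATED for Bałaban's objects: as
in seam (β), `StepBudget` is built only from abstract binders over abstract types `Dom`, `Cube` and abstract activities
`wA wB : ℕ → Dom → ℂ` (cell ABSOLUTE RULE; lineage handoff (R3)).

ABSOLUTE RULE.  NOTHING of [Balaban 1983–89] is quoted as authority or asserted here; no display is transcribed; no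
programme-internal claim is cited; no `[cite:]` tag; page numbers are LOCATIONS.  Every declaration is [folklore]
bookkeeping over `T4MatchingClosureYoung` §4, `T4MatchingClosureTwoRun` §1–§2 and `T4EpochHorizon` §4.

DICTIONARY.  As in `T4MatchingClosureTwoRun` (steps `j` of the window `Icc (jlogOf C K) K`; catalogues `Cat j ⊇ Disc j`;
footprints / outside cubes / reach / `d j`; activities `wA j`, `wB j`; the age predicate `Young j`; anchoring sets
`Qy j`, `Qo j`; the term's nested ledger `t` with step remnant leaves `rem j` and domains `dom`), plus: `birth j Z` = the
creation step of the sub-history hosting the young polymer `Z` met at step `j`; `G j Z` = its geometric genealogy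
ledger (`T4GeometricLedger.GeoLedger dd κ η`: lattice dimension `dd`, lineage names `κ`, region names `η`); `D j Z`,
`bk j Z` = its booked-mass bound and its bank; `st j Z i` = the start scale of its epoch `i`; `Clean j Z i` = that
epoch's cleanliness predicate; `F`, `Rw`, `β′`, `x̄`, `c̄`, `L₁`, `r` = the flow of (I.0.20) up to `K`, its typed (2.5)
windows and their majorants (ONE flow per cutoff); `c_e, c_s, p̄₀` = the S-side constants; `Nsz` = the size parameter
of the stopping rule.  Renamings forced by the join: seam (β)'s decay rate `R`, constant `s`, function `d` and
incompatibility relation `ι` keep their names, so the producer's window function is `Rw`, its start scales `st`, its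
dimension `dd`, its region type `η`, its bank `bk`.

CONTENTS.  §1 `step_le_birth_add_youngWindow_of_geometric_stopping`, `youngRate_of_geometric_stopping`.  §2
`windowRate_nonneg`, `birthRate_le_windowRate`, `rate_of_birthRate`, `windowRate_clause`, `hrate_of_birth`;
`stepBudget_of_twoRun_birth`, `remnant_le_of_twoRun_birth`, `steps_feed_of_twoRun_birth`.  §3
`window_of_geometric_stopping`, `stepBudget_of_twoRun_geometric`, `steps_feed_of_twoRun_geometric`.  §4 sanity
(`six_lt_ageCut_ten_one`, `flatFlow_satisfiesRG`; §1 on `geoEx` at `K = 1`; §2, §3 on the empty catalogue).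

Value = kernel certificate that the young RATE clause of the node-U5 budget is fed, by name, from birth-step two-run
rates and Lemma Y on geometric genealogy ledgers — the abstract-window / abstract-rate binders of the U5 closure's young
remnant side resolved to named producer obligations; NOT an estimate, NOT summit progress.  Unit `b2b-balaban-pv02`
gen 13 (journal CLAIM T4-U5.E-CLOSE*-BIRTH 2026-08-19T06:46:17Z).
-/

open Finset

namespace Literature.MathematicalPhysics.QuantumFieldTheory.Balaban1983to89.T4MatchingClosureBirth

open Literature.MathematicalPhysics.QuantumFieldTheory.Balaban1983to89

/-! ## §1 One sub-history: the window clause and the young rate from a geometric genealogy ledger -/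

section SubHistory

open B16SProfile B16StoppingRule T4GeometricLedger T4RemnantBooking T4BankAgeYoung T4MatchingClosureYoung
  T4EpochHorizon

variable {dd : ℕ} {κ η : Type*} [DecidableEq κ] [DecidableEq η]

/-- **THE WINDOW CLAUSE OF ONE YOUNG SUB-HISTORY, BY NAME** (`T4MatchingClosureYoung.step_le_birth_add_window` ∘
`T4EpochHorizon.lifetime_lt_youngWindow_of_geometric_stopping`): a sub-history met at step `j` and born at step `b`,
whose geometric genealogy ledger `G` is `Geometric`, founded in epoch `0`, consumes alive lineages and obeys the
producer's binders at cutoff `K` (S-side credits with the bank `bk` below the age-cut credit `c_e p̄₀·ageCut C′ K`, the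
flow of (I.0.20) up to `K` with its typed (2.5) windows `Rw`, start scales `st i ≤ K`, `Nsz ≥ 64`, cleanliness, the
STOPPING READING), and whose epochs cover `j` (`hcover : j ≤ b + Σ_{i ≤ E} steps (base i)`), satisfies
`j ≤ b + youngWindow dd L₁ r (modelC dd) C′ x̄ c̄ K`.  Every hypothesis of the producer is a BINDER here, as there;
nothing PRINTED is asserted. [folklore] -/
theorem step_le_birth_add_youngWindow_of_geometric_stopping (G : GeoLedger dd κ η) (hG : G.Geometric)
    (h0 : G.base₀ ∈ G.founded 0) (hc : ∀ e, e < G.E → G.consumed e ⊆ G.toLedger.alive e) (hdd : 1 ≤ dd)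
    {D : ℕ} {C' : ℝ} {K : ℕ} (hDD : G.toLedger₂.Dtot ≤ (D : ℝ))
    {ce cs p₀ bk : ℝ} (hce : 0 < ce) (hp : 0 < p₀) (hP5 : ce ≤ cs * p₀)
    (hbk : ce * p₀ * G.E + cs * p₀ ^ 2 * D ≤ bk) (hbA : bk < ce * p₀ * ageCut C' K)
    (F : Flow) {β' : ℝ} (hβ' : 0 ≤ β') {L₁ r : ℕ} (hL : 1 ≤ L₁)
    (hpos : ∀ j, j ≤ K → 0 < F.g j) (hle1 : ∀ j, j ≤ K → F.g j ≤ 1) (hrg : F.SatisfiesRG K)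
    (hub : ∀ j, j < K → F.β (j + 1) (F.g j) ≤ β') (Rw : ℕ → ℕ)
    (hRj : ∀ j, j ≤ K → B14.IsRj L₁ r (F.g j) (Rw j))
    {x c : ℝ} (hx : 0 ≤ x) (hcc : 0 ≤ c) (hxK : Real.log ((F.g K) ^ 2)⁻¹ ≤ x) (hcK : (F.g K) ^ 2 * β' ≤ c)
    {st : ℕ → ℕ} (hst : ∀ i, i ≤ G.E → st i ≤ K)
    {Nsz : ℕ} (hNsz : 64 ≤ Nsz) (Clean : ℕ → ℕ → Prop)
    (hclean : ∀ i, i ≤ G.E → ∀ l, 1 ≤ l → l ≤ G.steps (G.base i) → Clean i l)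
    (hstop : ∀ i, i ≤ G.E → ∀ K', K' ≤ G.steps (G.base i) →
      StopAt Nsz (Rw (st i)) (Clean i) (fun n => Siter (ratio G.L (G.expo (G.base i))) n (G.dom (G.base i))) K' →
        G.steps (G.base i) ≤ K')
    {j b : ℕ} (hcover : (j : ℝ) ≤ b + ∑ i ∈ Finset.range (G.E + 1), ((G.steps (G.base i) : ℕ) : ℝ)) :
    j ≤ b + youngWindow dd L₁ r (T4EpochSize.modelC dd) C' x c K :=
  step_le_birth_add_window hcover
    (lifetime_lt_youngWindow_of_geometric_stopping G hG h0 hc hdd hDD hce hp hP5 hbk hbA F hβ' hL hpos hle1 hrg hub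
      Rw hRj hx hcc hxK hcK hst hNsz Clean hclean hstop).2

/-- **THE YOUNG RATE OF ONE SUB-HISTORY, BY NAME** (`T4MatchingClosureYoung.youngRate_of_lifetime_lt` ∘
`T4EpochHorizon.lifetime_lt_youngWindow_of_geometric_stopping`; `0 < θ ≤ 1`, `0 ≤ C_r`): under the binders of
`step_le_birth_add_youngWindow_of_geometric_stopping`, the birth-step rate is at most the window rate at the canonical
young window, `C_r·θ^b ≤ C_r·θ^j·θ^{−youngWindow dd L₁ r (modelC dd) C′ x̄ c̄ K}` — the upper half of
`T4MatchingClosureFed.StepBudget.rate` at step `j` for the profile `r_j := C_r·θ^b`, with seam (α)'s free lifetime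
binder `hℓ` replaced by the producer's named binders. [folklore] -/
theorem youngRate_of_geometric_stopping {θ : ℝ} (hθ : 0 < θ) (hθ1 : θ ≤ 1) {Cr : ℝ} (hCr : 0 ≤ Cr)
    (G : GeoLedger dd κ η) (hG : G.Geometric)
    (h0 : G.base₀ ∈ G.founded 0) (hc : ∀ e, e < G.E → G.consumed e ⊆ G.toLedger.alive e) (hdd : 1 ≤ dd)
    {D : ℕ} {C' : ℝ} {K : ℕ} (hDD : G.toLedger₂.Dtot ≤ (D : ℝ))
    {ce cs p₀ bk : ℝ} (hce : 0 < ce) (hp : 0 < p₀) (hP5 : ce ≤ cs * p₀)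
    (hbk : ce * p₀ * G.E + cs * p₀ ^ 2 * D ≤ bk) (hbA : bk < ce * p₀ * ageCut C' K)
    (F : Flow) {β' : ℝ} (hβ' : 0 ≤ β') {L₁ r : ℕ} (hL : 1 ≤ L₁)
    (hpos : ∀ j, j ≤ K → 0 < F.g j) (hle1 : ∀ j, j ≤ K → F.g j ≤ 1) (hrg : F.SatisfiesRG K)
    (hub : ∀ j, j < K → F.β (j + 1) (F.g j) ≤ β') (Rw : ℕ → ℕ)
    (hRj : ∀ j, j ≤ K → B14.IsRj L₁ r (F.g j) (Rw j))
    {x c : ℝ} (hx : 0 ≤ x) (hcc : 0 ≤ c) (hxK : Real.log ((F.g K) ^ 2)⁻¹ ≤ x) (hcK : (F.g K) ^ 2 * β' ≤ c)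
    {st : ℕ → ℕ} (hst : ∀ i, i ≤ G.E → st i ≤ K)
    {Nsz : ℕ} (hNsz : 64 ≤ Nsz) (Clean : ℕ → ℕ → Prop)
    (hclean : ∀ i, i ≤ G.E → ∀ l, 1 ≤ l → l ≤ G.steps (G.base i) → Clean i l)
    (hstop : ∀ i, i ≤ G.E → ∀ K', K' ≤ G.steps (G.base i) →
      StopAt Nsz (Rw (st i)) (Clean i) (fun n => Siter (ratio G.L (G.expo (G.base i))) n (G.dom (G.base i))) K' →
        G.steps (G.base i) ≤ K')
    {j b : ℕ} (hcover : (j : ℝ) ≤ b + ∑ i ∈ Finset.range (G.E + 1), ((G.steps (G.base i) : ℕ) : ℝ)) :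
    Cr * θ ^ b ≤ Cr * θ ^ j * θ⁻¹ ^ youngWindow dd L₁ r (T4EpochSize.modelC dd) C' x c K :=
  youngRate_of_lifetime_lt hθ hθ1 hCr (W := youngWindow dd L₁ r (T4EpochSize.modelC dd) C' x c) hcover
    (lifetime_lt_youngWindow_of_geometric_stopping G hG h0 hc hdd hDD hce hp hP5 hbk hbA F hβ' hL hpos hle1 hrg hub
      Rw hRj hx hcc hxK hcK hst hNsz Clean hclean hstop).2

end SubHistory

/-! ## §2 The window, two-run level: `StepBudget` from birth-step rates and the window clause -/

section RateArith

open T4GoodClassBudget T4MatchingClosureYoung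

variable {θ : ℝ}

/-- The window rate `C_r·θ^j·θ^{−w}` is non-negative (`0 < θ`, `0 ≤ C_r`): the lower half of `StepBudget.rate` for
the saturating profile. [folklore] -/
theorem windowRate_nonneg (hθ : 0 < θ) {Cr : ℝ} (hCr : 0 ≤ Cr) (j w : ℕ) : 0 ≤ Cr * θ ^ j * θ⁻¹ ^ w :=
  mul_nonneg (mul_nonneg hCr (pow_nonneg hθ.le _)) (pow_nonneg (inv_nonneg.2 hθ.le) _)

/-- **BIRTH-STEP RATE ≤ WINDOW RATE** (`T4MatchingClosureYoung.pow_birth_le_windowRate` scaled by `0 ≤ C_r`): for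
`0 < θ ≤ 1` and `j ≤ b + w`, `C_r·θ^b ≤ C_r·θ^j·θ^{−w}`. [folklore] -/
theorem birthRate_le_windowRate (hθ : 0 < θ) (hθ1 : θ ≤ 1) {Cr : ℝ} (hCr : 0 ≤ Cr) {j b w : ℕ} (h : j ≤ b + w) :
    Cr * θ ^ b ≤ Cr * θ ^ j * θ⁻¹ ^ w := by
  rw [mul_assoc]
  exact mul_le_mul_of_nonneg_left (pow_birth_le_windowRate hθ hθ1 h) hCr

/-- **A TWO-RUN RATE AT THE BIRTH STEP IS A WINDOW RATE AT THE CURRENT STEP**: if `nrm ≤ C_r·θ^b·env` with a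
non-negative envelope `env` (e.g. `A·e^{−R d}`) and `j ≤ b + w`, then `nrm ≤ (C_r·θ^j·θ^{−w})·env` — the shape of the
`hrate` clause of `T4MatchingClosureTwoRun.stepBudget_of_twoRun` for the saturating profile. [folklore] -/
theorem rate_of_birthRate (hθ : 0 < θ) (hθ1 : θ ≤ 1) {Cr : ℝ} (hCr : 0 ≤ Cr) {j b w : ℕ} (h : j ≤ b + w)
    {nrm env : ℝ} (henv : 0 ≤ env) (hn : nrm ≤ Cr * θ ^ b * env) : nrm ≤ Cr * θ ^ j * θ⁻¹ ^ w * env :=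
  hn.trans (mul_le_mul_of_nonneg_right (birthRate_le_windowRate hθ hθ1 hCr h) henv)

/-- The saturating profile `ry j := C_r·θ^j·θ^{−W(K)}` satisfies the `rate` clause of `StepBudget` (the `hry` binder
of seam (β)) on the window. [folklore] -/
theorem windowRate_clause (hθ : 0 < θ) {Cr : ℝ} (hCr : 0 ≤ Cr) (C : ℝ) (W : ℕ → ℕ) (K : ℕ) :
    ∀ j ∈ Icc (jlogOf C K) K, 0 ≤ Cr * θ ^ j * θ⁻¹ ^ W K ∧ Cr * θ ^ j * θ⁻¹ ^ W K ≤ Cr * θ ^ j * θ⁻¹ ^ W K :=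
  fun j _ => ⟨windowRate_nonneg hθ hCr j (W K), le_rfl⟩

variable {Dom : Type*}

/-- **THE `hrate` BINDER OF SEAM (β) FROM BIRTH-STEP DATA**: on the young discrepant polymers of the window, a two-run
rate at the birth step (`hbirth`) and the window clause `j ≤ birth j Z + W(K)` (`hwin`) give seam (β)'s per-polymer
rate hypothesis for the saturating profile (`0 < θ ≤ 1`, `0 ≤ C_r`, `0 ≤ A`). [folklore] -/
theorem hrate_of_birth (hθ : 0 < θ) (hθ1 : θ ≤ 1) {Cr : ℝ} (hCr : 0 ≤ Cr) {C : ℝ} {K : ℕ} {W : ℕ → ℕ}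
    {Disc : ℕ → Finset Dom} {d : ℕ → Dom → ℝ} {wA wB : ℕ → Dom → ℂ} {A R : ℝ} (hA : 0 ≤ A)
    (Young : ℕ → Dom → Prop) (birth : ℕ → Dom → ℕ)
    (hbirth : ∀ j ∈ Icc (jlogOf C K) K, ∀ Z ∈ Disc j, Young j Z →
      ‖wA j Z - wB j Z‖ ≤ Cr * θ ^ birth j Z * (A * Real.exp (-(R * d j Z))))
    (hwin : ∀ j ∈ Icc (jlogOf C K) K, ∀ Z ∈ Disc j, Young j Z → j ≤ birth j Z + W K) :
    ∀ j ∈ Icc (jlogOf C K) K, ∀ Z ∈ Disc j, Young j Z →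
      ‖wA j Z - wB j Z‖ ≤ Cr * θ ^ j * θ⁻¹ ^ W K * (A * Real.exp (-(R * d j Z))) :=
  fun j hj Z hZ hY =>
    rate_of_birthRate hθ hθ1 hCr (hwin j hj Z hZ hY) (mul_nonneg hA (Real.exp_pos _).le) (hbirth j hj Z hZ hY)

end RateArith

section TwoRunBirth

open Literature.Probability.LatticeModels
open B13FamilySum B16Exp198 B16Exp198TwoRun T4NestedLevels T4RemnantBooking T4GoodClassBudget T4MatchingClosureRem
  T4MatchingClosureFed T4TwoRunRateAssembly T4MatchingClosureTwoRun

variable {Dom Cube : Type*} [DecidableEq Dom] [DecidableEq Cube]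
variable (ι : Dom → Dom → Prop) [DecidableRel ι]

/-- **SEAM (γ), TWO-RUN LEVEL: `StepBudget` FROM BIRTH-STEP RATES.**  `T4MatchingClosureTwoRun.stepBudget_of_twoRun`
with the abstract young rate triple (`ry`, `hry`, `hrate`) REPLACED by: `0 < θ ≤ 1`, `0 ≤ C_r`, a birth map `birth`,
the two-run rate AT THE BIRTH STEP on the young discrepant polymers of the window
(`hbirth : ‖w_A,j(Z) − w_B,j(Z)‖ ≤ C_r·θ^{birth j Z}·(A e^{−R d_j(Z)})`) and the window clause
`hwin : j ≤ birth j Z + W(K)`; every other binder verbatim.  The rate profile of the resulting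
`StepBudget C C′ θ ρ (A·e^{b+τc₁}·K₀) C_r vol Λ W K rad ry #Q_y #Q_o` is the saturating one `ry j = C_r·θ^j·θ^{−W(K)}`.
Binders only; nothing asserted. [folklore] -/
theorem stepBudget_of_twoRun_birth [Fintype Dom] [Std.Refl ι] [Std.Symm ι]
    {C C' θ ρ Cr vol Λ : ℝ} {W : ℕ → ℕ} {K : ℕ} (hθ : 0 < θ) (hθ1 : θ ≤ 1) (hCr : 0 ≤ Cr)
    {Cat Disc : ℕ → Finset Dom} (hDisc : ∀ j, Disc j ⊆ Cat j)
    {cubes out reach : ℕ → Dom → Finset Cube} {d : ℕ → Dom → ℝ} {wA wB : ℕ → Dom → ℂ}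
    {A R r₁ s κ₀ K₀ c₁ b τ ν : ℝ}
    (hloc : ∀ j Z, ∀ Z' ∈ Cat j, ι Z' Z → ∃ q ∈ reach j Z, q ∈ out j Z')
    (hreach : ∀ j Z, ((reach j Z).card : ℝ) ≤ ν * (out j Z).card)
    (hd : ∀ j Z, 0 ≤ d j Z) (hA : 0 ≤ A) (hK₀ : 0 ≤ K₀) (hτ : 0 ≤ τ) (hρ : 0 ≤ ρ)
    (hr₁ : 0 ≤ r₁) (hs : 0 ≤ s) (hb : 0 ≤ b)
    (hwAΛ : ∀ j Z, Z ∉ Cat j → wA j Z = 0) (hwBΛ : ∀ j Z, Z ∉ Cat j → wB j Z = 0)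
    (hwA : ∀ j Z, ‖wA j Z‖ ≤ A * Real.exp (-(R * d j Z)))
    (hwB : ∀ j Z, ‖wB j Z‖ ≤ A * Real.exp (-(R * d j Z)))
    (hzero : ∀ j, ∀ Z ∈ Cat j, Z ∉ Disc j → wA j Z = wB j Z)
    (Young : ℕ → Dom → Prop) [∀ j, DecidablePred (Young j)] (birth : ℕ → Dom → ℕ)
    (hbirth : ∀ j ∈ Icc (jlogOf C K) K, ∀ Z ∈ Disc j, Young j Z →
      ‖wA j Z - wB j Z‖ ≤ Cr * θ ^ birth j Z * (A * Real.exp (-(R * d j Z))))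
    (hwin : ∀ j ∈ Icc (jlogOf C K) K, ∀ Z ∈ Disc j, Young j Z → j ≤ birth j Z + W K)
    (hsizeA : ∀ j ∈ Icc (jlogOf C K) K, ∀ Z ∈ Disc j, ¬Young j Z →
      ‖wA j Z‖ ≤ ρ ^ ageCut C' K * (A * Real.exp (-(R * d j Z))))
    (hsizeB : ∀ j ∈ Icc (jlogOf C K) K, ∀ Z ∈ Disc j, ¬Young j Z →
      ‖wB j Z‖ ≤ ρ ^ ageCut C' K * (A * Real.exp (-(R * d j Z))))
    (h126 : ∀ j, Ineq126 (Cat j) (out j) (d j) κ₀ K₀) (hvol : ∀ j, VolBound (Cat j) (out j) (d j) c₁)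
    (hrate' : κ₀ + (r₁ + s) + τ * c₁ ≤ R) (hsmall : A * Real.exp (b + τ * c₁) * K₀ * ν ≤ τ)
    {Qy Qo : ℕ → Finset Cube}
    (hQy : ∀ j ∈ Icc (jlogOf C K) K, ∀ Z ∈ Disc j, Young j Z → ∃ q ∈ Qy j, q ∈ out j Z)
    (hQo : ∀ j ∈ Icc (jlogOf C K) K, ∀ Z ∈ Disc j, ¬Young j Z → ∃ q ∈ Qo j, q ∈ out j Z)
    (hQyc : ∀ j ∈ Icc (jlogOf C K) K, ((Qy j).card : ℝ) ≤ vol * Λ ^ (K - j))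
    (hQoc : ∀ j ∈ Icc (jlogOf C K) K, ((Qo j).card : ℝ) ≤ vol * Λ ^ (K - j))
    {ιL O : Type*} [DecidableEq ιL] {t : Ledger ιL O} (hnd : t.leaves.Nodup) (rem : ℕ → Finset ιL)
    {dom : ιL → Finset Cube} (hinj : ∀ j, Set.InjOn dom ↑(rem j)) :
    StepBudget C C' θ ρ (A * Real.exp (b + τ * c₁) * K₀) Cr vol Λ W K
      (fun j => t.leafSum fun i => if i ∈ rem j then
        ‖locR ι (Cat j) (cubes j) (wA j) (dom i) - locR ι (Cat j) (cubes j) (wB j) (dom i)‖ else 0)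
      (fun j => Cr * θ ^ j * θ⁻¹ ^ W K) (fun j => ((Qy j).card : ℝ)) (fun j => ((Qo j).card : ℝ)) :=
  stepBudget_of_twoRun ι (ry := fun j => Cr * θ ^ j * θ⁻¹ ^ W K) (windowRate_clause hθ hCr C W K) hDisc hloc
    hreach hd hA hK₀ hτ hρ hr₁ hs hb hwAΛ hwBΛ hwA hwB hzero Young
    (hrate_of_birth hθ hθ1 hCr hA Young birth hbirth hwin) hsizeA hsizeB h126 hvol hrate' hsmall hQy hQo hQyc hQoc
    hnd rem hinj

/-- **ONE TERM FROM BIRTH-STEP RATES** (`T4MatchingClosureTwoRun.remnant_le_of_twoRun` with the same replacement): a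
remnant radius `RrRem` dominated by the window sum of the step leaf sums obeys
`RrRem ≤ vol·((E·C_r)·remnantYoungW θ Λ C W K) + vol·remnantOld (fun _ n ↦ 2Eρⁿ) Λ C C′ K`, `E = A·e^{b+τc₁}·K₀`.
[folklore] -/
theorem remnant_le_of_twoRun_birth [Fintype Dom] [Std.Refl ι] [Std.Symm ι]
    {C C' θ ρ Cr vol Λ : ℝ} {W : ℕ → ℕ} {K : ℕ} (hθ : 0 < θ) (hθ1 : θ ≤ 1) (hCr : 0 ≤ Cr)
    {Cat Disc : ℕ → Finset Dom} (hDisc : ∀ j, Disc j ⊆ Cat j)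
    {cubes out reach : ℕ → Dom → Finset Cube} {d : ℕ → Dom → ℝ} {wA wB : ℕ → Dom → ℂ}
    {A R r₁ s κ₀ K₀ c₁ b τ ν : ℝ}
    (hloc : ∀ j Z, ∀ Z' ∈ Cat j, ι Z' Z → ∃ q ∈ reach j Z, q ∈ out j Z')
    (hreach : ∀ j Z, ((reach j Z).card : ℝ) ≤ ν * (out j Z).card)
    (hd : ∀ j Z, 0 ≤ d j Z) (hA : 0 ≤ A) (hK₀ : 0 ≤ K₀) (hτ : 0 ≤ τ) (hρ : 0 ≤ ρ)
    (hr₁ : 0 ≤ r₁) (hs : 0 ≤ s) (hb : 0 ≤ b)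
    (hwAΛ : ∀ j Z, Z ∉ Cat j → wA j Z = 0) (hwBΛ : ∀ j Z, Z ∉ Cat j → wB j Z = 0)
    (hwA : ∀ j Z, ‖wA j Z‖ ≤ A * Real.exp (-(R * d j Z)))
    (hwB : ∀ j Z, ‖wB j Z‖ ≤ A * Real.exp (-(R * d j Z)))
    (hzero : ∀ j, ∀ Z ∈ Cat j, Z ∉ Disc j → wA j Z = wB j Z)
    (Young : ℕ → Dom → Prop) [∀ j, DecidablePred (Young j)] (birth : ℕ → Dom → ℕ)
    (hbirth : ∀ j ∈ Icc (jlogOf C K) K, ∀ Z ∈ Disc j, Young j Z →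
      ‖wA j Z - wB j Z‖ ≤ Cr * θ ^ birth j Z * (A * Real.exp (-(R * d j Z))))
    (hwin : ∀ j ∈ Icc (jlogOf C K) K, ∀ Z ∈ Disc j, Young j Z → j ≤ birth j Z + W K)
    (hsizeA : ∀ j ∈ Icc (jlogOf C K) K, ∀ Z ∈ Disc j, ¬Young j Z →
      ‖wA j Z‖ ≤ ρ ^ ageCut C' K * (A * Real.exp (-(R * d j Z))))
    (hsizeB : ∀ j ∈ Icc (jlogOf C K) K, ∀ Z ∈ Disc j, ¬Young j Z →
      ‖wB j Z‖ ≤ ρ ^ ageCut C' K * (A * Real.exp (-(R * d j Z))))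
    (h126 : ∀ j, Ineq126 (Cat j) (out j) (d j) κ₀ K₀) (hvol : ∀ j, VolBound (Cat j) (out j) (d j) c₁)
    (hrate' : κ₀ + (r₁ + s) + τ * c₁ ≤ R) (hsmall : A * Real.exp (b + τ * c₁) * K₀ * ν ≤ τ)
    {Qy Qo : ℕ → Finset Cube}
    (hQy : ∀ j ∈ Icc (jlogOf C K) K, ∀ Z ∈ Disc j, Young j Z → ∃ q ∈ Qy j, q ∈ out j Z)
    (hQo : ∀ j ∈ Icc (jlogOf C K) K, ∀ Z ∈ Disc j, ¬Young j Z → ∃ q ∈ Qo j, q ∈ out j Z)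
    (hQyc : ∀ j ∈ Icc (jlogOf C K) K, ((Qy j).card : ℝ) ≤ vol * Λ ^ (K - j))
    (hQoc : ∀ j ∈ Icc (jlogOf C K) K, ((Qo j).card : ℝ) ≤ vol * Λ ^ (K - j))
    {ιL O : Type*} [DecidableEq ιL] {t : Ledger ιL O} (hnd : t.leaves.Nodup) (rem : ℕ → Finset ιL)
    {dom : ιL → Finset Cube} (hinj : ∀ j, Set.InjOn dom ↑(rem j)) {RrRem : ℝ}
    (hRem : RrRem ≤ ∑ j ∈ Icc (jlogOf C K) K, t.leafSum fun i => if i ∈ rem j then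
      ‖locR ι (Cat j) (cubes j) (wA j) (dom i) - locR ι (Cat j) (cubes j) (wB j) (dom i)‖ else 0) :
    RrRem ≤ vol * (((A * Real.exp (b + τ * c₁) * K₀) * Cr) * remnantYoungW θ Λ C W K) +
      vol * remnantOld (fun _ n => 2 * (A * Real.exp (b + τ * c₁) * K₀) * ρ ^ n) Λ C C' K :=
  remnant_le_of_twoRun ι (ry := fun j => Cr * θ ^ j * θ⁻¹ ^ W K) (windowRate_clause hθ hCr C W K) hDisc hloc
    hreach hd hA hK₀ hτ hρ hr₁ hs hb hwAΛ hwBΛ hwA hwB hzero Young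
    (hrate_of_birth hθ hθ1 hCr hA Young birth hbirth hwin) hsizeA hsizeB h126 hvol hrate' hsmall hQy hQo hQyc hQoc
    hnd rem hinj hRem

/-- **THE EXISTENTIAL FEED FROM BIRTH-STEP RATES** (`T4MatchingClosureTwoRun.steps_feed_of_twoRun` with the same
replacement): `∃ rad ry Qy Qo, StepBudget … ∧ RrRem ≤ Σ_j rad j` — the consumer's per-term binder `hsteps` of
`T4MatchingClosureFed.hybridNE7_closure_fed_steps` (at `W := youngWindow …`: of
`T4MatchingClosureYoung.hybridNE7_closure_fed_steps_youngWindow`) inhabited from birth-step two-run data. [folklore] -/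
theorem steps_feed_of_twoRun_birth [Fintype Dom] [Std.Refl ι] [Std.Symm ι]
    {C C' θ ρ Cr vol Λ : ℝ} {W : ℕ → ℕ} {K : ℕ} (hθ : 0 < θ) (hθ1 : θ ≤ 1) (hCr : 0 ≤ Cr)
    {Cat Disc : ℕ → Finset Dom} (hDisc : ∀ j, Disc j ⊆ Cat j)
    {cubes out reach : ℕ → Dom → Finset Cube} {d : ℕ → Dom → ℝ} {wA wB : ℕ → Dom → ℂ}
    {A R r₁ s κ₀ K₀ c₁ b τ ν : ℝ}
    (hloc : ∀ j Z, ∀ Z' ∈ Cat j, ι Z' Z → ∃ q ∈ reach j Z, q ∈ out j Z')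
    (hreach : ∀ j Z, ((reach j Z).card : ℝ) ≤ ν * (out j Z).card)
    (hd : ∀ j Z, 0 ≤ d j Z) (hA : 0 ≤ A) (hK₀ : 0 ≤ K₀) (hτ : 0 ≤ τ) (hρ : 0 ≤ ρ)
    (hr₁ : 0 ≤ r₁) (hs : 0 ≤ s) (hb : 0 ≤ b)
    (hwAΛ : ∀ j Z, Z ∉ Cat j → wA j Z = 0) (hwBΛ : ∀ j Z, Z ∉ Cat j → wB j Z = 0)
    (hwA : ∀ j Z, ‖wA j Z‖ ≤ A * Real.exp (-(R * d j Z)))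
    (hwB : ∀ j Z, ‖wB j Z‖ ≤ A * Real.exp (-(R * d j Z)))
    (hzero : ∀ j, ∀ Z ∈ Cat j, Z ∉ Disc j → wA j Z = wB j Z)
    (Young : ℕ → Dom → Prop) [∀ j, DecidablePred (Young j)] (birth : ℕ → Dom → ℕ)
    (hbirth : ∀ j ∈ Icc (jlogOf C K) K, ∀ Z ∈ Disc j, Young j Z →
      ‖wA j Z - wB j Z‖ ≤ Cr * θ ^ birth j Z * (A * Real.exp (-(R * d j Z))))
    (hwin : ∀ j ∈ Icc (jlogOf C K) K, ∀ Z ∈ Disc j, Young j Z → j ≤ birth j Z + W K)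
    (hsizeA : ∀ j ∈ Icc (jlogOf C K) K, ∀ Z ∈ Disc j, ¬Young j Z →
      ‖wA j Z‖ ≤ ρ ^ ageCut C' K * (A * Real.exp (-(R * d j Z))))
    (hsizeB : ∀ j ∈ Icc (jlogOf C K) K, ∀ Z ∈ Disc j, ¬Young j Z →
      ‖wB j Z‖ ≤ ρ ^ ageCut C' K * (A * Real.exp (-(R * d j Z))))
    (h126 : ∀ j, Ineq126 (Cat j) (out j) (d j) κ₀ K₀) (hvol : ∀ j, VolBound (Cat j) (out j) (d j) c₁)
    (hrate' : κ₀ + (r₁ + s) + τ * c₁ ≤ R) (hsmall : A * Real.exp (b + τ * c₁) * K₀ * ν ≤ τ)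
    {Qy Qo : ℕ → Finset Cube}
    (hQy : ∀ j ∈ Icc (jlogOf C K) K, ∀ Z ∈ Disc j, Young j Z → ∃ q ∈ Qy j, q ∈ out j Z)
    (hQo : ∀ j ∈ Icc (jlogOf C K) K, ∀ Z ∈ Disc j, ¬Young j Z → ∃ q ∈ Qo j, q ∈ out j Z)
    (hQyc : ∀ j ∈ Icc (jlogOf C K) K, ((Qy j).card : ℝ) ≤ vol * Λ ^ (K - j))
    (hQoc : ∀ j ∈ Icc (jlogOf C K) K, ((Qo j).card : ℝ) ≤ vol * Λ ^ (K - j))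
    {ιL O : Type*} [DecidableEq ιL] {t : Ledger ιL O} (hnd : t.leaves.Nodup) (rem : ℕ → Finset ιL)
    {dom : ιL → Finset Cube} (hinj : ∀ j, Set.InjOn dom ↑(rem j)) {RrRem : ℝ}
    (hRem : RrRem ≤ ∑ j ∈ Icc (jlogOf C K) K, t.leafSum fun i => if i ∈ rem j then
      ‖locR ι (Cat j) (cubes j) (wA j) (dom i) - locR ι (Cat j) (cubes j) (wB j) (dom i)‖ else 0) :
    ∃ rad ry Qy' Qo' : ℕ → ℝ,
      StepBudget C C' θ ρ (A * Real.exp (b + τ * c₁) * K₀) Cr vol Λ W K rad ry Qy' Qo' ∧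
        RrRem ≤ ∑ j ∈ Icc (jlogOf C K) K, rad j :=
  steps_feed_of_twoRun ι (ry := fun j => Cr * θ ^ j * θ⁻¹ ^ W K) (windowRate_clause hθ hCr C W K) hDisc hloc
    hreach hd hA hK₀ hτ hρ hr₁ hs hb hwAΛ hwBΛ hwA hwB hzero Young
    (hrate_of_birth hθ hθ1 hCr hA Young birth hbirth hwin) hsizeA hsizeB h126 hvol hrate' hsmall hQy hQo hQyc hQoc
    hnd rem hinj hRem

end TwoRunBirth

/-! ## §3 The join: the window clause discharged per young polymer by §1 at `W := youngWindow …` -/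

section Geometric

open T4GoodClassBudget T4RemnantBooking T4BankAgeYoung

variable {Dom : Type*} {dd : ℕ} {κ η : Type*} [DecidableEq κ] [DecidableEq η]

/-- **THE WINDOW CLAUSE DISCHARGED ON THE WINDOW** (§1 per young discrepant polymer): if every young discrepant polymer
`Z ∈ Disc j`, `j ∈ [jlog_C K, K]`, is hosted by a sub-history born at step `birth j Z` whose geometric genealogy ledger
`G j Z` is `Geometric` and obeys the producer's binders at cutoff `K` — uniform: the S-side constants `c_e, c_s, p̄₀`,
ONE flow `F` with its typed (2.5) windows `Rw` and majorants `β′, x̄, c̄`, the size parameter `Nsz`; per polymer: the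
booked mass `D j Z`, the bank `bk j Z` below the age-cut credit, start scales `st j Z i ≤ K`, cleanliness `Clean j Z`,
the STOPPING READING, and the covering `j ≤ birth j Z + Σ_{i ≤ E} steps (base i)` — then the window clause `hwin` of
§2 holds at `W := youngWindow dd L₁ r (modelC dd) C′ x̄ c̄`.  Binders only; nothing asserted. [folklore] -/
theorem window_of_geometric_stopping {C C' : ℝ} {K : ℕ} {Disc : ℕ → Finset Dom} (Young : ℕ → Dom → Prop)
    (birth : ℕ → Dom → ℕ) (hdd : 1 ≤ dd) (G : ℕ → Dom → T4GeometricLedger.GeoLedger dd κ η)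
    (hG : ∀ j ∈ Icc (jlogOf C K) K, ∀ Z ∈ Disc j, Young j Z → (G j Z).Geometric)
    (h0 : ∀ j ∈ Icc (jlogOf C K) K, ∀ Z ∈ Disc j, Young j Z → (G j Z).base₀ ∈ (G j Z).founded 0)
    (hc : ∀ j ∈ Icc (jlogOf C K) K, ∀ Z ∈ Disc j, Young j Z →
      ∀ e, e < (G j Z).E → (G j Z).consumed e ⊆ (G j Z).toLedger.alive e)
    {D : ℕ → Dom → ℕ}
    (hDD : ∀ j ∈ Icc (jlogOf C K) K, ∀ Z ∈ Disc j, Young j Z → (G j Z).toLedger₂.Dtot ≤ (D j Z : ℝ))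
    {ce cs p₀ : ℝ} {bk : ℕ → Dom → ℝ} (hce : 0 < ce) (hp : 0 < p₀) (hP5 : ce ≤ cs * p₀)
    (hbk : ∀ j ∈ Icc (jlogOf C K) K, ∀ Z ∈ Disc j, Young j Z →
      ce * p₀ * (G j Z).E + cs * p₀ ^ 2 * D j Z ≤ bk j Z)
    (hbA : ∀ j ∈ Icc (jlogOf C K) K, ∀ Z ∈ Disc j, Young j Z → bk j Z < ce * p₀ * ageCut C' K)
    (F : Flow) {β' : ℝ} (hβ' : 0 ≤ β') {L₁ r : ℕ} (hL : 1 ≤ L₁)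
    (hpos : ∀ j, j ≤ K → 0 < F.g j) (hle1 : ∀ j, j ≤ K → F.g j ≤ 1) (hrg : F.SatisfiesRG K)
    (hub : ∀ j, j < K → F.β (j + 1) (F.g j) ≤ β') (Rw : ℕ → ℕ)
    (hRj : ∀ j, j ≤ K → B14.IsRj L₁ r (F.g j) (Rw j))
    {x c : ℝ} (hx : 0 ≤ x) (hcc : 0 ≤ c) (hxK : Real.log ((F.g K) ^ 2)⁻¹ ≤ x) (hcK : (F.g K) ^ 2 * β' ≤ c)
    {st : ℕ → Dom → ℕ → ℕ}
    (hst : ∀ j ∈ Icc (jlogOf C K) K, ∀ Z ∈ Disc j, Young j Z → ∀ i, i ≤ (G j Z).E → st j Z i ≤ K)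
    {Nsz : ℕ} (hNsz : 64 ≤ Nsz) (Clean : ℕ → Dom → ℕ → ℕ → Prop)
    (hclean : ∀ j ∈ Icc (jlogOf C K) K, ∀ Z ∈ Disc j, Young j Z →
      ∀ i, i ≤ (G j Z).E → ∀ l, 1 ≤ l → l ≤ (G j Z).steps ((G j Z).base i) → Clean j Z i l)
    (hstop : ∀ j ∈ Icc (jlogOf C K) K, ∀ Z ∈ Disc j, Young j Z →
      ∀ i, i ≤ (G j Z).E → ∀ K', K' ≤ (G j Z).steps ((G j Z).base i) →
        B16StoppingRule.StopAt Nsz (Rw (st j Z i)) (Clean j Z i)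
          (fun n => B16SProfile.Siter (B16SProfile.ratio (G j Z).L ((G j Z).expo ((G j Z).base i))) n
            ((G j Z).dom ((G j Z).base i))) K' →
        (G j Z).steps ((G j Z).base i) ≤ K')
    (hcover : ∀ j ∈ Icc (jlogOf C K) K, ∀ Z ∈ Disc j, Young j Z →
      (j : ℝ) ≤ birth j Z + ∑ i ∈ Finset.range ((G j Z).E + 1), (((G j Z).steps ((G j Z).base i) : ℕ) : ℝ)) :
    ∀ j ∈ Icc (jlogOf C K) K, ∀ Z ∈ Disc j, Young j Z →
      j ≤ birth j Z + youngWindow dd L₁ r (T4EpochSize.modelC dd) C' x c K :=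
  fun j hj Z hZ hY =>
    step_le_birth_add_youngWindow_of_geometric_stopping (G j Z) (hG j hj Z hZ hY) (h0 j hj Z hZ hY) (hc j hj Z hZ hY)
      hdd (hDD j hj Z hZ hY) hce hp hP5 (hbk j hj Z hZ hY) (hbA j hj Z hZ hY) F hβ' hL hpos hle1 hrg hub Rw hRj hx hcc
      hxK hcK (hst j hj Z hZ hY) hNsz (Clean j Z) (hclean j hj Z hZ hY) (hstop j hj Z hZ hY) (hcover j hj Z hZ hY)

end Geometric

section GeometricTwoRun

open Literature.Probability.LatticeModels
open B13FamilySum B16Exp198 B16Exp198TwoRun T4NestedLevels T4RemnantBooking T4GoodClassBudget T4MatchingClosureRem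
  T4MatchingClosureFed T4TwoRunRateAssembly T4MatchingClosureTwoRun

variable {Dom Cube : Type*} [DecidableEq Dom] [DecidableEq Cube]
variable (ι : Dom → Dom → Prop) [DecidableRel ι]
variable {dd : ℕ} {κ η : Type*} [DecidableEq κ] [DecidableEq η]

/-- **SEAM (γ) END TO END: `StepBudget` AT THE CANONICAL YOUNG WINDOW FROM BIRTH-STEP RATES AND GEOMETRIC GENEALOGY
LEDGERS** (`stepBudget_of_twoRun_birth` at `W := youngWindow dd L₁ r (modelC dd) C′ x̄ c̄` ∘
`window_of_geometric_stopping`): seam (β)'s binders verbatim except the rate triple, plus `0 < θ ≤ 1`, `0 ≤ C_r`, the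
birth map and the birth-step rate `hbirth`, plus the producer's binders for the hosting sub-histories of the young
discrepant polymers (uniform S-side constants, ONE flow per cutoff, `Nsz`; per polymer `G, hG, h0, hc, hDD, hbk, hbA,
hst, hclean, hstop, hcover`).  No abstract window, no abstract rate profile, no free lifetime is left: every remaining
binder is a named producer obligation.  `StepBudget` is instantiated from abstract binders only; nothing PRINTED is
asserted. [folklore] -/
theorem stepBudget_of_twoRun_geometric [Fintype Dom] [Std.Refl ι] [Std.Symm ι]
    {C C' θ ρ Cr vol Λ : ℝ} {K : ℕ} (hθ : 0 < θ) (hθ1 : θ ≤ 1) (hCr : 0 ≤ Cr)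
    {Cat Disc : ℕ → Finset Dom} (hDisc : ∀ j, Disc j ⊆ Cat j)
    {cubes out reach : ℕ → Dom → Finset Cube} {d : ℕ → Dom → ℝ} {wA wB : ℕ → Dom → ℂ}
    {A R r₁ s κ₀ K₀ c₁ b τ ν : ℝ}
    (hloc : ∀ j Z, ∀ Z' ∈ Cat j, ι Z' Z → ∃ q ∈ reach j Z, q ∈ out j Z')
    (hreach : ∀ j Z, ((reach j Z).card : ℝ) ≤ ν * (out j Z).card)
    (hd : ∀ j Z, 0 ≤ d j Z) (hA : 0 ≤ A) (hK₀ : 0 ≤ K₀) (hτ : 0 ≤ τ) (hρ : 0 ≤ ρ)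
    (hr₁ : 0 ≤ r₁) (hs : 0 ≤ s) (hb : 0 ≤ b)
    (hwAΛ : ∀ j Z, Z ∉ Cat j → wA j Z = 0) (hwBΛ : ∀ j Z, Z ∉ Cat j → wB j Z = 0)
    (hwA : ∀ j Z, ‖wA j Z‖ ≤ A * Real.exp (-(R * d j Z)))
    (hwB : ∀ j Z, ‖wB j Z‖ ≤ A * Real.exp (-(R * d j Z)))
    (hzero : ∀ j, ∀ Z ∈ Cat j, Z ∉ Disc j → wA j Z = wB j Z)
    (Young : ℕ → Dom → Prop) [∀ j, DecidablePred (Young j)] (birth : ℕ → Dom → ℕ)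
    (hbirth : ∀ j ∈ Icc (jlogOf C K) K, ∀ Z ∈ Disc j, Young j Z →
      ‖wA j Z - wB j Z‖ ≤ Cr * θ ^ birth j Z * (A * Real.exp (-(R * d j Z))))
    (hdd : 1 ≤ dd) (G : ℕ → Dom → T4GeometricLedger.GeoLedger dd κ η)
    (hG : ∀ j ∈ Icc (jlogOf C K) K, ∀ Z ∈ Disc j, Young j Z → (G j Z).Geometric)
    (h0 : ∀ j ∈ Icc (jlogOf C K) K, ∀ Z ∈ Disc j, Young j Z → (G j Z).base₀ ∈ (G j Z).founded 0)
    (hc : ∀ j ∈ Icc (jlogOf C K) K, ∀ Z ∈ Disc j, Young j Z →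
      ∀ e, e < (G j Z).E → (G j Z).consumed e ⊆ (G j Z).toLedger.alive e)
    {D : ℕ → Dom → ℕ}
    (hDD : ∀ j ∈ Icc (jlogOf C K) K, ∀ Z ∈ Disc j, Young j Z → (G j Z).toLedger₂.Dtot ≤ (D j Z : ℝ))
    {ce cs p₀ : ℝ} {bk : ℕ → Dom → ℝ} (hce : 0 < ce) (hp : 0 < p₀) (hP5 : ce ≤ cs * p₀)
    (hbk : ∀ j ∈ Icc (jlogOf C K) K, ∀ Z ∈ Disc j, Young j Z →
      ce * p₀ * (G j Z).E + cs * p₀ ^ 2 * D j Z ≤ bk j Z)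
    (hbA : ∀ j ∈ Icc (jlogOf C K) K, ∀ Z ∈ Disc j, Young j Z → bk j Z < ce * p₀ * ageCut C' K)
    (F : Flow) {β' : ℝ} (hβ' : 0 ≤ β') {L₁ r : ℕ} (hL : 1 ≤ L₁)
    (hpos : ∀ j, j ≤ K → 0 < F.g j) (hle1 : ∀ j, j ≤ K → F.g j ≤ 1) (hrg : F.SatisfiesRG K)
    (hub : ∀ j, j < K → F.β (j + 1) (F.g j) ≤ β') (Rw : ℕ → ℕ)
    (hRj : ∀ j, j ≤ K → B14.IsRj L₁ r (F.g j) (Rw j))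
    {x c : ℝ} (hx : 0 ≤ x) (hcc : 0 ≤ c) (hxK : Real.log ((F.g K) ^ 2)⁻¹ ≤ x) (hcK : (F.g K) ^ 2 * β' ≤ c)
    {st : ℕ → Dom → ℕ → ℕ}
    (hst : ∀ j ∈ Icc (jlogOf C K) K, ∀ Z ∈ Disc j, Young j Z → ∀ i, i ≤ (G j Z).E → st j Z i ≤ K)
    {Nsz : ℕ} (hNsz : 64 ≤ Nsz) (Clean : ℕ → Dom → ℕ → ℕ → Prop)
    (hclean : ∀ j ∈ Icc (jlogOf C K) K, ∀ Z ∈ Disc j, Young j Z →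
      ∀ i, i ≤ (G j Z).E → ∀ l, 1 ≤ l → l ≤ (G j Z).steps ((G j Z).base i) → Clean j Z i l)
    (hstop : ∀ j ∈ Icc (jlogOf C K) K, ∀ Z ∈ Disc j, Young j Z →
      ∀ i, i ≤ (G j Z).E → ∀ K', K' ≤ (G j Z).steps ((G j Z).base i) →
        B16StoppingRule.StopAt Nsz (Rw (st j Z i)) (Clean j Z i)
          (fun n => B16SProfile.Siter (B16SProfile.ratio (G j Z).L ((G j Z).expo ((G j Z).base i))) n
            ((G j Z).dom ((G j Z).base i))) K' →
        (G j Z).steps ((G j Z).base i) ≤ K')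
    (hcover : ∀ j ∈ Icc (jlogOf C K) K, ∀ Z ∈ Disc j, Young j Z →
      (j : ℝ) ≤ birth j Z + ∑ i ∈ Finset.range ((G j Z).E + 1), (((G j Z).steps ((G j Z).base i) : ℕ) : ℝ))
    (hsizeA : ∀ j ∈ Icc (jlogOf C K) K, ∀ Z ∈ Disc j, ¬Young j Z →
      ‖wA j Z‖ ≤ ρ ^ ageCut C' K * (A * Real.exp (-(R * d j Z))))
    (hsizeB : ∀ j ∈ Icc (jlogOf C K) K, ∀ Z ∈ Disc j, ¬Young j Z →
      ‖wB j Z‖ ≤ ρ ^ ageCut C' K * (A * Real.exp (-(R * d j Z))))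
    (h126 : ∀ j, Ineq126 (Cat j) (out j) (d j) κ₀ K₀) (hvol : ∀ j, VolBound (Cat j) (out j) (d j) c₁)
    (hrate' : κ₀ + (r₁ + s) + τ * c₁ ≤ R) (hsmall : A * Real.exp (b + τ * c₁) * K₀ * ν ≤ τ)
    {Qy Qo : ℕ → Finset Cube}
    (hQy : ∀ j ∈ Icc (jlogOf C K) K, ∀ Z ∈ Disc j, Young j Z → ∃ q ∈ Qy j, q ∈ out j Z)
    (hQo : ∀ j ∈ Icc (jlogOf C K) K, ∀ Z ∈ Disc j, ¬Young j Z → ∃ q ∈ Qo j, q ∈ out j Z)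
    (hQyc : ∀ j ∈ Icc (jlogOf C K) K, ((Qy j).card : ℝ) ≤ vol * Λ ^ (K - j))
    (hQoc : ∀ j ∈ Icc (jlogOf C K) K, ((Qo j).card : ℝ) ≤ vol * Λ ^ (K - j))
    {ιL O : Type*} [DecidableEq ιL] {t : Ledger ιL O} (hnd : t.leaves.Nodup) (rem : ℕ → Finset ιL)
    {dom : ιL → Finset Cube} (hinj : ∀ j, Set.InjOn dom ↑(rem j)) :
    StepBudget C C' θ ρ (A * Real.exp (b + τ * c₁) * K₀) Cr vol Λ
      (T4BankAgeYoung.youngWindow dd L₁ r (T4EpochSize.modelC dd) C' x c) K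
      (fun j => t.leafSum fun i => if i ∈ rem j then
        ‖locR ι (Cat j) (cubes j) (wA j) (dom i) - locR ι (Cat j) (cubes j) (wB j) (dom i)‖ else 0)
      (fun j => Cr * θ ^ j * θ⁻¹ ^ T4BankAgeYoung.youngWindow dd L₁ r (T4EpochSize.modelC dd) C' x c K)
      (fun j => ((Qy j).card : ℝ)) (fun j => ((Qo j).card : ℝ)) :=
  stepBudget_of_twoRun_birth ι (W := T4BankAgeYoung.youngWindow dd L₁ r (T4EpochSize.modelC dd) C' x c) hθ hθ1 hCr
    hDisc hloc hreach hd hA hK₀ hτ hρ hr₁ hs hb hwAΛ hwBΛ hwA hwB hzero Young birth hbirth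
    (window_of_geometric_stopping Young birth hdd G hG h0 hc hDD hce hp hP5 hbk hbA F hβ' hL hpos hle1 hrg hub Rw hRj
      hx hcc hxK hcK hst hNsz Clean hclean hstop hcover)
    hsizeA hsizeB h126 hvol hrate' hsmall hQy hQo hQyc hQoc hnd rem hinj

/-- **THE EXISTENTIAL FEED, END TO END** (`steps_feed_of_twoRun_birth` at `W := youngWindow …` ∘
`window_of_geometric_stopping`): the per-term binder `hsteps` of
`T4MatchingClosureYoung.hybridNE7_closure_fed_steps_youngWindow` / `stringHybridNE7_closure_fed_steps_youngWindow`
inhabited from birth-step two-run data and the geometric genealogy ledgers of the young discrepant polymers' hosting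
sub-histories. [folklore] -/
theorem steps_feed_of_twoRun_geometric [Fintype Dom] [Std.Refl ι] [Std.Symm ι]
    {C C' θ ρ Cr vol Λ : ℝ} {K : ℕ} (hθ : 0 < θ) (hθ1 : θ ≤ 1) (hCr : 0 ≤ Cr)
    {Cat Disc : ℕ → Finset Dom} (hDisc : ∀ j, Disc j ⊆ Cat j)
    {cubes out reach : ℕ → Dom → Finset Cube} {d : ℕ → Dom → ℝ} {wA wB : ℕ → Dom → ℂ}
    {A R r₁ s κ₀ K₀ c₁ b τ ν : ℝ}
    (hloc : ∀ j Z, ∀ Z' ∈ Cat j, ι Z' Z → ∃ q ∈ reach j Z, q ∈ out j Z')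
    (hreach : ∀ j Z, ((reach j Z).card : ℝ) ≤ ν * (out j Z).card)
    (hd : ∀ j Z, 0 ≤ d j Z) (hA : 0 ≤ A) (hK₀ : 0 ≤ K₀) (hτ : 0 ≤ τ) (hρ : 0 ≤ ρ)
    (hr₁ : 0 ≤ r₁) (hs : 0 ≤ s) (hb : 0 ≤ b)
    (hwAΛ : ∀ j Z, Z ∉ Cat j → wA j Z = 0) (hwBΛ : ∀ j Z, Z ∉ Cat j → wB j Z = 0)
    (hwA : ∀ j Z, ‖wA j Z‖ ≤ A * Real.exp (-(R * d j Z)))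
    (hwB : ∀ j Z, ‖wB j Z‖ ≤ A * Real.exp (-(R * d j Z)))
    (hzero : ∀ j, ∀ Z ∈ Cat j, Z ∉ Disc j → wA j Z = wB j Z)
    (Young : ℕ → Dom → Prop) [∀ j, DecidablePred (Young j)] (birth : ℕ → Dom → ℕ)
    (hbirth : ∀ j ∈ Icc (jlogOf C K) K, ∀ Z ∈ Disc j, Young j Z →
      ‖wA j Z - wB j Z‖ ≤ Cr * θ ^ birth j Z * (A * Real.exp (-(R * d j Z))))
    (hdd : 1 ≤ dd) (G : ℕ → Dom → T4GeometricLedger.GeoLedger dd κ η)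
    (hG : ∀ j ∈ Icc (jlogOf C K) K, ∀ Z ∈ Disc j, Young j Z → (G j Z).Geometric)
    (h0 : ∀ j ∈ Icc (jlogOf C K) K, ∀ Z ∈ Disc j, Young j Z → (G j Z).base₀ ∈ (G j Z).founded 0)
    (hc : ∀ j ∈ Icc (jlogOf C K) K, ∀ Z ∈ Disc j, Young j Z →
      ∀ e, e < (G j Z).E → (G j Z).consumed e ⊆ (G j Z).toLedger.alive e)
    {D : ℕ → Dom → ℕ}
    (hDD : ∀ j ∈ Icc (jlogOf C K) K, ∀ Z ∈ Disc j, Young j Z → (G j Z).toLedger₂.Dtot ≤ (D j Z : ℝ))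
    {ce cs p₀ : ℝ} {bk : ℕ → Dom → ℝ} (hce : 0 < ce) (hp : 0 < p₀) (hP5 : ce ≤ cs * p₀)
    (hbk : ∀ j ∈ Icc (jlogOf C K) K, ∀ Z ∈ Disc j, Young j Z →
      ce * p₀ * (G j Z).E + cs * p₀ ^ 2 * D j Z ≤ bk j Z)
    (hbA : ∀ j ∈ Icc (jlogOf C K) K, ∀ Z ∈ Disc j, Young j Z → bk j Z < ce * p₀ * ageCut C' K)
    (F : Flow) {β' : ℝ} (hβ' : 0 ≤ β') {L₁ r : ℕ} (hL : 1 ≤ L₁)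
    (hpos : ∀ j, j ≤ K → 0 < F.g j) (hle1 : ∀ j, j ≤ K → F.g j ≤ 1) (hrg : F.SatisfiesRG K)
    (hub : ∀ j, j < K → F.β (j + 1) (F.g j) ≤ β') (Rw : ℕ → ℕ)
    (hRj : ∀ j, j ≤ K → B14.IsRj L₁ r (F.g j) (Rw j))
    {x c : ℝ} (hx : 0 ≤ x) (hcc : 0 ≤ c) (hxK : Real.log ((F.g K) ^ 2)⁻¹ ≤ x) (hcK : (F.g K) ^ 2 * β' ≤ c)
    {st : ℕ → Dom → ℕ → ℕ}
    (hst : ∀ j ∈ Icc (jlogOf C K) K, ∀ Z ∈ Disc j, Young j Z → ∀ i, i ≤ (G j Z).E → st j Z i ≤ K)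
    {Nsz : ℕ} (hNsz : 64 ≤ Nsz) (Clean : ℕ → Dom → ℕ → ℕ → Prop)
    (hclean : ∀ j ∈ Icc (jlogOf C K) K, ∀ Z ∈ Disc j, Young j Z →
      ∀ i, i ≤ (G j Z).E → ∀ l, 1 ≤ l → l ≤ (G j Z).steps ((G j Z).base i) → Clean j Z i l)
    (hstop : ∀ j ∈ Icc (jlogOf C K) K, ∀ Z ∈ Disc j, Young j Z →
      ∀ i, i ≤ (G j Z).E → ∀ K', K' ≤ (G j Z).steps ((G j Z).base i) →
        B16StoppingRule.StopAt Nsz (Rw (st j Z i)) (Clean j Z i)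
          (fun n => B16SProfile.Siter (B16SProfile.ratio (G j Z).L ((G j Z).expo ((G j Z).base i))) n
            ((G j Z).dom ((G j Z).base i))) K' →
        (G j Z).steps ((G j Z).base i) ≤ K')
    (hcover : ∀ j ∈ Icc (jlogOf C K) K, ∀ Z ∈ Disc j, Young j Z →
      (j : ℝ) ≤ birth j Z + ∑ i ∈ Finset.range ((G j Z).E + 1), (((G j Z).steps ((G j Z).base i) : ℕ) : ℝ))
    (hsizeA : ∀ j ∈ Icc (jlogOf C K) K, ∀ Z ∈ Disc j, ¬Young j Z →
      ‖wA j Z‖ ≤ ρ ^ ageCut C' K * (A * Real.exp (-(R * d j Z))))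
    (hsizeB : ∀ j ∈ Icc (jlogOf C K) K, ∀ Z ∈ Disc j, ¬Young j Z →
      ‖wB j Z‖ ≤ ρ ^ ageCut C' K * (A * Real.exp (-(R * d j Z))))
    (h126 : ∀ j, Ineq126 (Cat j) (out j) (d j) κ₀ K₀) (hvol : ∀ j, VolBound (Cat j) (out j) (d j) c₁)
    (hrate' : κ₀ + (r₁ + s) + τ * c₁ ≤ R) (hsmall : A * Real.exp (b + τ * c₁) * K₀ * ν ≤ τ)
    {Qy Qo : ℕ → Finset Cube}
    (hQy : ∀ j ∈ Icc (jlogOf C K) K, ∀ Z ∈ Disc j, Young j Z → ∃ q ∈ Qy j, q ∈ out j Z)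
    (hQo : ∀ j ∈ Icc (jlogOf C K) K, ∀ Z ∈ Disc j, ¬Young j Z → ∃ q ∈ Qo j, q ∈ out j Z)
    (hQyc : ∀ j ∈ Icc (jlogOf C K) K, ((Qy j).card : ℝ) ≤ vol * Λ ^ (K - j))
    (hQoc : ∀ j ∈ Icc (jlogOf C K) K, ((Qo j).card : ℝ) ≤ vol * Λ ^ (K - j))
    {ιL O : Type*} [DecidableEq ιL] {t : Ledger ιL O} (hnd : t.leaves.Nodup) (rem : ℕ → Finset ιL)
    {dom : ιL → Finset Cube} (hinj : ∀ j, Set.InjOn dom ↑(rem j)) {RrRem : ℝ}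
    (hRem : RrRem ≤ ∑ j ∈ Icc (jlogOf C K) K, t.leafSum fun i => if i ∈ rem j then
      ‖locR ι (Cat j) (cubes j) (wA j) (dom i) - locR ι (Cat j) (cubes j) (wB j) (dom i)‖ else 0) :
    ∃ rad ry Qy' Qo' : ℕ → ℝ,
      StepBudget C C' θ ρ (A * Real.exp (b + τ * c₁) * K₀) Cr vol Λ
          (T4BankAgeYoung.youngWindow dd L₁ r (T4EpochSize.modelC dd) C' x c) K rad ry Qy' Qo' ∧
        RrRem ≤ ∑ j ∈ Icc (jlogOf C K) K, rad j :=
  steps_feed_of_twoRun_birth ι (W := T4BankAgeYoung.youngWindow dd L₁ r (T4EpochSize.modelC dd) C' x c) hθ hθ1 hCr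
    hDisc hloc hreach hd hA hK₀ hτ hρ hr₁ hs hb hwAΛ hwBΛ hwA hwB hzero Young birth hbirth
    (window_of_geometric_stopping Young birth hdd G hG h0 hc hDD hce hp hP5 hbk hbA F hβ' hL hpos hle1 hrg hub Rw hRj
      hx hcc hxK hcK hst hNsz Clean hclean hstop hcover)
    hsizeA hsizeB h126 hvol hrate' hsmall hQy hQo hQyc hQoc hnd rem hinj hRem

end GeometricTwoRun

/-! ## §4 Sanity: §1 inhabited at a positive cutoff; §2, §3 inhabited by the empty catalogue -/

section Sanity

open B16SProfile B16StoppingRule T4GeometricLedger T4RemnantBooking T4BankAgeYoung T4EpochHorizon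

/-- At `C′ = 10`, `K = 1` the age cut `⌈10·log 2⌉₊` exceeds `6` (`Real.log_two_gt_d9`): a positive cutoff at which
the bank credit `c_e p̄₀·ageCut C′ K` of the (Y3) form is inhabitable. [folklore] -/
theorem six_lt_ageCut_ten_one : (6 : ℝ) < (ageCut 10 1 : ℝ) := by
  have h2 : (6 : ℝ) < 10 * Real.log 2 := by linarith [Real.log_two_gt_d9]
  have h : ((1 : ℕ) : ℝ) + 1 = 2 := by norm_num
  rw [ageCut, h]
  exact h2.trans_le (Nat.le_ceil _)

/-- The flat one-scale flow `g ≡ 1`, `β ≡ 0` obeys (I.0.20) up to every `K`. [folklore] -/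
theorem flatFlow_satisfiesRG (K : ℕ) : (⟨fun _ => 1, fun _ _ => 0⟩ : Flow).SatisfiesRG K :=
  fun _ _ => by simp

/-- **§1 IS INHABITED AT A POSITIVE CUTOFF** (the (Y3) form exercised): `youngRate_of_geometric_stopping` APPLIED to
the test ledger `geoEx` of `…T4GeometricLedger` §4 (`dd = 1`, one founded cube, one event at once — all step counts `0`)
at `K = 1`, `C′ = 10` (bank `bk = 5 < 1·1·⌈10·log 2⌉₊`, `six_lt_ageCut_ten_one`), S-side data `D = 4 = Dtot₂`,
`c_e = c_s = p̄₀ = 1`, the FLAT FLOW `g ≡ 1`, `β ≡ 0` with windows `Rw ≡ 1`, `β′ = x̄ = c̄ = 0`, `L₁ = r = 1`, start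
scales `st ≡ 0`, `Nsz = 64`, everything clean, a sub-history met at its birth step `j = b` (lifetime `0`); conclusion
`C_r·θ^b ≤ C_r·θ^b·θ^{−youngWindow 1 1 1 (modelC 1) 10 0 0 1}`. [folklore] -/
example {θ Cr : ℝ} (hθ : 0 < θ) (hθ1 : θ ≤ 1) (hCr : 0 ≤ Cr) (b : ℕ) :
    Cr * θ ^ b ≤ Cr * θ ^ b * θ⁻¹ ^ youngWindow 1 1 1 (T4EpochSize.modelC 1) 10 0 0 1 :=
  youngRate_of_geometric_stopping hθ hθ1 hCr geoEx geoEx_geometric (by simp [geoEx])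
    (fun e he => by
      have he0 : e = 0 := by simp only [geoEx] at he; omega
      subst he0
      simp [geoEx, GeoLedger.toLedger])
    le_rfl (D := 4) (C' := 10) (K := 1) (by rw [geoEx_Dtot₂]; norm_num) (ce := 1) (cs := 1) (p₀ := 1) (bk := 5)
    one_pos one_pos (by norm_num) (by norm_num [geoEx]) (by linarith [six_lt_ageCut_ten_one])
    ⟨fun _ => 1, fun _ _ => 0⟩ (β' := 0) le_rfl (L₁ := 1) (r := 1) le_rfl (fun _ _ => one_pos) (fun _ _ => le_rfl)
    (flatFlow_satisfiesRG 1) (fun _ _ => le_rfl) (fun _ => 1) (fun _ _ => isRj_one) (x := 0) (c := 0) le_rfl le_rfl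
    (by simp) (by simp) (st := fun _ => 0) (fun _ _ => Nat.zero_le _) (Nsz := 64) le_rfl (fun _ _ => True)
    (fun _ _ _ _ _ => trivial) (fun i _ K' _ _ => by simp [geoEx]) (j := b) (b := b) (by simp)

end Sanity

section SanityTwoRun

open Literature.Probability.LatticeModels
open B13FamilySum B16Exp198 B16Exp198TwoRun T4NestedLevels T4RemnantBooking T4GoodClassBudget T4MatchingClosureRem
  T4MatchingClosureFed T4TwoRunRateAssembly T4MatchingClosureTwoRun T4GeometricLedger T4EpochHorizon

/-- SANITY (non-vacuity of the hypothesis set of `stepBudget_of_twoRun_birth`): the EMPTY catalogue at every step (as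
in `T4MatchingClosureTwoRun` §4: `Dom = Cube = Unit`, the total relation, `Cat j = Disc j = ∅`, activities `0`, one-leaf
ledger, `rem j = ∅`, all constants `0` except `c₁ = K₀ = 1`), births `0`, any `0 < θ ≤ 1`, `C_r = 1`: a `StepBudget`
with `rad = 0` and the saturating rate profile. [folklore] -/
example (C C' θ ρ vol Λ : ℝ) (hθ : 0 < θ) (hθ1 : θ ≤ 1) (hρ : 0 ≤ ρ) (hvol : 0 ≤ vol) (hΛ : 0 ≤ Λ) (W : ℕ → ℕ)
    (K : ℕ) :
    StepBudget C C' θ ρ (0 * Real.exp (0 + 0 * 1) * 1) 1 vol Λ W K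
      (fun j => (Ledger.leaf () : Ledger Unit Unit).leafSum fun i => if i ∈ (fun _ : ℕ => (∅ : Finset Unit)) j then
        ‖locR (fun _ _ : Unit => True) ((fun _ : ℕ => (∅ : Finset Unit)) j)
            ((fun _ : ℕ => fun _ : Unit => (∅ : Finset Unit)) j) ((fun _ : ℕ => fun _ : Unit => (0 : ℂ)) j)
            ((fun _ : Unit => (∅ : Finset Unit)) i) -
          locR (fun _ _ : Unit => True) ((fun _ : ℕ => (∅ : Finset Unit)) j)
            ((fun _ : ℕ => fun _ : Unit => (∅ : Finset Unit)) j) ((fun _ : ℕ => fun _ : Unit => (0 : ℂ)) j)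
            ((fun _ : Unit => (∅ : Finset Unit)) i)‖ else 0)
      (fun j => 1 * θ ^ j * θ⁻¹ ^ W K) (fun j => (((fun _ : ℕ => (∅ : Finset Unit)) j).card : ℝ))
      (fun j => (((fun _ : ℕ => (∅ : Finset Unit)) j).card : ℝ)) := by
  haveI : Std.Refl (fun _ _ : Unit => True) := ⟨fun _ => trivial⟩
  haveI : Std.Symm (fun _ _ : Unit => True) := ⟨fun _ _ _ => trivial⟩
  exact stepBudget_of_twoRun_birth (fun _ _ : Unit => True) (C := C) (C' := C') (θ := θ) (ρ := ρ) (Cr := 1)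
    (vol := vol) (Λ := Λ) (W := W) (K := K) hθ hθ1 zero_le_one
    (Cat := fun _ => ∅) (Disc := fun _ => ∅) (fun _ => Finset.Subset.refl _)
    (cubes := fun _ _ => ∅) (out := fun _ _ => ∅) (reach := fun _ _ => ∅) (d := fun _ _ => 0)
    (wA := fun _ _ => 0) (wB := fun _ _ => 0) (A := 0) (R := 0) (r₁ := 0) (s := 0) (κ₀ := 0) (K₀ := 1) (c₁ := 1)
    (b := 0) (τ := 0) (ν := 0)
    (fun _ _ Z' hZ' _ => by simp at hZ') (fun _ _ => by simp) (fun _ _ => le_rfl) le_rfl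
    zero_le_one le_rfl hρ le_rfl le_rfl le_rfl (fun _ _ _ => rfl) (fun _ _ _ => rfl) (fun _ _ => by simp)
    (fun _ _ => by simp) (fun _ Z hZ _ => by simp at hZ) (fun _ _ => False) (fun _ _ => 0)
    (fun _ _ Z hZ _ => by simp at hZ) (fun _ _ Z hZ _ => by simp at hZ)
    (fun _ _ Z hZ _ => by simp at hZ) (fun _ _ Z hZ _ => by simp at hZ)
    (fun _ c => by simp) (fun _ Y hY => by simp at hY) (by norm_num) (by norm_num) (Qy := fun _ => ∅) (Qo := fun _ => ∅)
    (fun _ _ Z hZ _ => by simp at hZ) (fun _ _ Z hZ _ => by simp at hZ)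
    (fun j _ => by simp; positivity) (fun j _ => by simp; positivity) (t := Ledger.leaf ()) (by simp [Ledger.leaves])
    (fun _ => ∅) (dom := fun _ => ∅) (fun _ => by simp)

/-- SANITY (non-vacuity of the hypothesis set of `stepBudget_of_twoRun_geometric`): the empty catalogue as above, every
young discrepant polymer (there is none) hosted by the test ledger `geoEx` (`dd = 1`), the FLAT FLOW `g ≡ 1`, `β ≡ 0`
at the cutoff `K` (windows `Rw ≡ 1`, `β′ = x̄ = c̄ = 0`, `L₁ = r = 1`), S-side constants `1`, `Nsz = 64`: a `StepBudget`
at the canonical young window `youngWindow 1 1 1 (modelC 1) C′ 0 0`. [folklore] -/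
example (C C' θ ρ vol Λ : ℝ) (hθ : 0 < θ) (hθ1 : θ ≤ 1) (hρ : 0 ≤ ρ) (hvol : 0 ≤ vol) (hΛ : 0 ≤ Λ) (K : ℕ) :
    StepBudget C C' θ ρ (0 * Real.exp (0 + 0 * 1) * 1) 1 vol Λ
      (T4BankAgeYoung.youngWindow 1 1 1 (T4EpochSize.modelC 1) C' 0 0) K
      (fun j => (Ledger.leaf () : Ledger Unit Unit).leafSum fun i => if i ∈ (fun _ : ℕ => (∅ : Finset Unit)) j then
        ‖locR (fun _ _ : Unit => True) ((fun _ : ℕ => (∅ : Finset Unit)) j)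
            ((fun _ : ℕ => fun _ : Unit => (∅ : Finset Unit)) j) ((fun _ : ℕ => fun _ : Unit => (0 : ℂ)) j)
            ((fun _ : Unit => (∅ : Finset Unit)) i) -
          locR (fun _ _ : Unit => True) ((fun _ : ℕ => (∅ : Finset Unit)) j)
            ((fun _ : ℕ => fun _ : Unit => (∅ : Finset Unit)) j) ((fun _ : ℕ => fun _ : Unit => (0 : ℂ)) j)
            ((fun _ : Unit => (∅ : Finset Unit)) i)‖ else 0)
      (fun j => 1 * θ ^ j * θ⁻¹ ^ T4BankAgeYoung.youngWindow 1 1 1 (T4EpochSize.modelC 1) C' 0 0 K)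
      (fun j => (((fun _ : ℕ => (∅ : Finset Unit)) j).card : ℝ))
      (fun j => (((fun _ : ℕ => (∅ : Finset Unit)) j).card : ℝ)) := by
  haveI : Std.Refl (fun _ _ : Unit => True) := ⟨fun _ => trivial⟩
  haveI : Std.Symm (fun _ _ : Unit => True) := ⟨fun _ _ _ => trivial⟩
  exact stepBudget_of_twoRun_geometric (fun _ _ : Unit => True) (C := C) (C' := C') (θ := θ) (ρ := ρ) (Cr := 1)
    (vol := vol) (Λ := Λ) (K := K) hθ hθ1 zero_le_one
    (Cat := fun _ => ∅) (Disc := fun _ => ∅) (fun _ => Finset.Subset.refl _)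
    (cubes := fun _ _ => ∅) (out := fun _ _ => ∅) (reach := fun _ _ => ∅) (d := fun _ _ => 0)
    (wA := fun _ _ => 0) (wB := fun _ _ => 0) (A := 0) (R := 0) (r₁ := 0) (s := 0) (κ₀ := 0) (K₀ := 1) (c₁ := 1)
    (b := 0) (τ := 0) (ν := 0)
    (fun _ _ Z' hZ' _ => by simp at hZ') (fun _ _ => by simp) (fun _ _ => le_rfl) le_rfl
    zero_le_one le_rfl hρ le_rfl le_rfl le_rfl (fun _ _ _ => rfl) (fun _ _ _ => rfl) (fun _ _ => by simp)
    (fun _ _ => by simp) (fun _ Z hZ _ => by simp at hZ) (fun _ _ => False) (fun _ _ => 0)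
    (fun _ _ Z hZ _ => by simp at hZ)
    (dd := 1) le_rfl (fun _ _ => geoEx) (fun _ _ Z hZ _ => by simp at hZ) (fun _ _ Z hZ _ => by simp at hZ)
    (fun _ _ Z hZ _ => by simp at hZ) (D := fun _ _ => 4) (fun _ _ Z hZ _ => by simp at hZ)
    (ce := 1) (cs := 1) (p₀ := 1) (bk := fun _ _ => 5) one_pos one_pos (by norm_num)
    (fun _ _ Z hZ _ => by simp at hZ) (fun _ _ Z hZ _ => by simp at hZ)
    ⟨fun _ => 1, fun _ _ => 0⟩ (β' := 0) le_rfl (L₁ := 1) (r := 1) le_rfl (fun _ _ => one_pos) (fun _ _ => le_rfl)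
    (flatFlow_satisfiesRG K) (fun _ _ => le_rfl) (fun _ => 1) (fun _ _ => isRj_one) (x := 0) (c := 0) le_rfl le_rfl
    (by simp) (by simp) (st := fun _ _ _ => 0) (fun _ _ Z hZ _ => by simp at hZ) (Nsz := 64) le_rfl
    (fun _ _ _ _ => True) (fun _ _ Z hZ _ => by simp at hZ) (fun _ _ Z hZ _ => by simp at hZ)
    (fun _ _ Z hZ _ => by simp at hZ)
    (fun _ _ Z hZ _ => by simp at hZ) (fun _ _ Z hZ _ => by simp at hZ)
    (fun _ c => by simp) (fun _ Y hY => by simp at hY) (by norm_num) (by norm_num) (Qy := fun _ => ∅) (Qo := fun _ => ∅)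
    (fun _ _ Z hZ _ => by simp at hZ) (fun _ _ Z hZ _ => by simp at hZ)
    (fun j _ => by simp; positivity) (fun j _ => by simp; positivity) (t := Ledger.leaf ()) (by simp [Ledger.leaves])
    (fun _ => ∅) (dom := fun _ => ∅) (fun _ => by simp)

end SanityTwoRun

end Literature.MathematicalPhysics.QuantumFieldTheory.Balaban1983to89.T4MatchingClosureBirth
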